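import Summits.QuantumFields.BalabanUV.Beta.GAN24.SliceFlatHessian
import Summits.QuantumFields.BalabanUV.Beta.GAN24.Entry112SupLogCubic

/-!
# Row G-an2-4 ∕ (CONV-C) — the SECOND-ORDER sup letters with `(1 + log n)`, VECTOR carrier, `U = 1`, `a = 1`, CUBIC unit tori:
# the four ENDs UNCONDITIONAL (the flat suppliers' second-order rows plugged into the `…_of_flat` packaging)

NOT IN PRINT; OUR BOOKKEEPING.  Cell `pub-balaban`, G-an2-4 crux team (coordinator ruling e34b3e0c (2)), leaf seat
`b2b-balaban-gan24-formalise-leaf-04` (gen 47), item «S2-TRANSPORT∕END» FILE 4 = the rider announced at journal `CLAIMS.log` l.28859 and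
type-checked jointly with the flat chain by `…-leaf-03` gen 48 (R-gan24leaf03-g48-1, l.28917; the rider text below is theirs, lifted with
thanks).  The ANALYSIS is `…-leaf-03`'s `GAN24/SliceFlatHeatSecond → SliceFlatHeatTorusSecond → SliceFlatFreeHessian → SliceFlatHessian`
(heat-kernel second differences; the located `log` = `∫₀^∞ (1∨2t)⁻¹e^{−t/(2n²)}dt`; the resolvent identity differenced twice); the TRANSPORT
and PACKAGING are FILES 1–2 of this item (`SndDiffRowSumTransport`, `Entry112SupLogCubic`); the LETTER SHAPES are `…-leaf-01` gen 54's
(`Entry112GradGradLog ∕ Sup112GradGradLog ∕ Entry112GDivDivLog ∕ Sup112GDivDivLog d 1`, staged; bodies copied at `M := fun _ => N₀`).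
0 `def`, 0 `def … : Prop`, 0 cite, 0 sorry.

WHAT IS PROVED (kernel): `hcol_swapped` (the flat OPERATOR-form END `SliceFlatHessian.cubeSum_gFlat_mul_colDiff_mul_colDiff_le` with its
bound variables in FILE 1's order `colDiff μ * colDiff ν` — a swap, nothing commuted) and the four ENDs, for every `n ≥ 1` and every cubic
unit torus `Π_μ ℤ/N₀`, with `δ₀, C > 0` functions of `d` only:
 * **`entry112GradGrad_one_cubic`**: `‖(∇_μ∇_νΔ_1⁻¹J)_κ(x)‖ ≤ C·(1 + log n)·e^{−δ₀|y−y′|_∞}·|J|` for `x ∈ B(y)`, `supp J ⊆ B(y′)`;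
 * **`sup112GradGrad_one_cubic`**: `‖∇_μ∇_νΔ_1⁻¹‖_{ℓ^∞→ℓ^∞} ≤ C·(1 + log n)`;
 * **`entry112GDivDiv_one_cubic`**: `‖(Δ_1⁻¹∇_μᴴ∇_νᴴJ)_κ(x)‖ ≤ C·(1 + log n)·e^{−δ₀|y−y′|_∞}·|J|`;
 * **`sup112GDivDiv_one_cubic`**: `‖Δ_1⁻¹∇_μᴴ∇_νᴴ‖_{ℓ^∞→ℓ^∞} ≤ C·(1 + log n)` — the road-P2 owner's `‖G′∂′ᴴ∂′ᴴ‖_{∞→∞}` letter (journal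
   l.28555) IN THE VECTOR CURRENCY.

HONEST SCOPE.  VECTOR `Δ_1⁻¹ = (B5DeltaA169.DeltaA n M 1)⁻¹` only, CUBIC tori only (the NE3 carrier has one period for all directions),
`a = 1`, `U = 1`; constants existential (functions of `d`); the `(1 + log n)` `ℓ^∞ → ℓ^∞` letters are OURS — [B5] Prop. 1.2 (1.112)–(1.113)
(`Balaban1984PropagatorsI` pp. 35–36) print HÖLDER-norm second-order entries without a log (a TEXT LOCATION, nothing printed is used).  The
requester's SCALAR `G′ = ScalarAveragedPropagator.Gps` is NOT served here (scalar item 0 is the located gap: journal N-gan24leaf03-g48-1 ∕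
N-gan24leaf04-g47-1).  NOT (CONV-C), NEVER «G-an2-4 closed», NOT NE2 ∕ NE3, NOT D1, NOT BetaPertH, NOT the continuum limit, NOT Clay.
HONEST DEPENDENCY: continuum YM on T⁴ ⇐ BetaPertH ∧ nine spine estimates (0/9 proved); BetaPertH ⇐ (D1) ∧ (D4) ∧ CAP+tail; G-an2-4 gates
asym, D1 and NE2/3/4.
-/

noncomputable section

open scoped BigOperators ComplexConjugate Matrix
open Finset

namespace Summit.QuantumFields.BalabanUV.Beta.GAN24.Entry112SupLogCubicFlat

open Literature.MathematicalPhysics.QuantumFieldTheory.Balaban1983to89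
open Literature.MathematicalPhysics.QuantumFieldTheory.Balaban1983to89.TreeLengthTorus (TPt)
open B5Prop11Plancherel (Tor fine fdiff)
open B5Block118 (bpt)
open B5Blocks16 (blockOf)
open B6LowerBound2153Torus (toT rep)
open B5DeltaA169 (DeltaA)
open B4TorusKernel.MultiPeriod (torusSupNorm)
open Summit.QuantumFields.BalabanUV.T4Continuum
open SliceTorusBlocks SliceTorusTower SliceCovariantTower SliceFlatPropagator SliceFlatFreeResolvent SliceFlatGradientPrep
open SndDiffRowSumTransport Entry112SupLogCubic

variable (d : ℕ)

/-- the flat OPERATOR-form END of `…-leaf-03` (`SliceFlatHessian.cubeSum_gFlat_mul_colDiff_mul_colDiff_le`, stated with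
`colDiff ν * colDiff μ`) with the bound variables in FILE 1's order `colDiff μ * colDiff ν` — a swap, nothing commuted. [folklore] -/
theorem hcol_swapped :
    ∃ B₂ δ : ℝ, 0 < B₂ ∧ 0 < δ ∧ ∀ (k N L : ℕ) [NeZero N] [NeZero L] (j : ℕ), j ≤ k →
      ∀ (μ ν : Fin (d + 1)) (p : TPt (d + 1) (N * L ^ k) × Fin (d + 1)) (y₁ : TPt (d + 1) (levM k N L j)),
        ∑ q ∈ Finset.univ.filter (fun q => cubeI (d + 1) k N L (Fin (d + 1)) j q = y₁),
            |(gFlat d k N L j * colDiff d k N L μ * colDiff d k N L ν) p q|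
          ≤ B₂ * (1 + Real.log ((L : ℝ) ^ j))
            * Real.exp (-(δ * nbd (d + 1) k N L j (cubeI (d + 1) k N L (Fin (d + 1)) j p) y₁)) := by
  obtain ⟨B₂, δ, hB, hδ, h⟩ := SliceFlatHessian.cubeSum_gFlat_mul_colDiff_mul_colDiff_le d
  exact ⟨B₂, δ, hB, hδ, fun k N L _ _ j hj μ ν p y₁ => h k N L j hj ν μ p y₁⟩

/-- **ROW FORM, LOCALIZED, UNCONDITIONAL**: for every `n ≥ 1`, every cubic unit torus `Π ℤ∕N₀`, all `μ ν y y′`, every `J` supported in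
`B(y′)` with `|J| ≤ B`, every `x = n·y + r`, `κ`: `‖(∇_μ∇_νΔ_1⁻¹J)_κ(x)‖ ≤ C·(1 + log n)·e^{−δ₀|y−y′|_∞}·B` — the body of `Entry112GradGradLog d 1`
at `M := fun _ => N₀` (FILE 2's `entry112GradGrad_one_cubic_of_flat` ∘ `SliceFlatHessian.cubeSum_rowDiff_rowDiff_gFlat_le`). [folklore] -/
theorem entry112GradGrad_one_cubic :
    ∃ δ₀ C : ℝ, 0 < δ₀ ∧ 0 < C ∧
      ∀ (n N₀ : ℕ) [NeZero n] [NeZero N₀], 1 ≤ n →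
        ∀ (μ ν : Fin (d + 1)) (y y' : Fin (d + 1) → ℤ) (J : Tor (fine n (fun _ : Fin (d + 1) => N₀)) × Fin (d + 1) → ℂ) (B : ℝ),
          (∀ j, ‖J j‖ ≤ B) →
          (∀ j, J j ≠ 0 → ∃ r' : Fin (d + 1) → Fin n,
              j.1 = bpt n (fun _ : Fin (d + 1) => N₀) (toT (fun _ : Fin (d + 1) => N₀) y') r') →
          ∀ (r : Fin (d + 1) → Fin n) (κ : Fin (d + 1)),
            ‖(fdiff (fine n (fun _ : Fin (d + 1) => N₀)) (n : ℂ) μ *ᵥ (fdiff (fine n (fun _ : Fin (d + 1) => N₀)) (n : ℂ) ν *ᵥ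
                ((DeltaA n (fun _ : Fin (d + 1) => N₀) 1)⁻¹ *ᵥ J))) (bpt n (fun _ : Fin (d + 1) => N₀) (toT (fun _ : Fin (d + 1) => N₀) y) r, κ)‖
              ≤ C * (1 + Real.log n) * Real.exp (-(δ₀ * torusSupNorm (fun _ : Fin (d + 1) => N₀) (y - y'))) * B :=
  entry112GradGrad_one_cubic_of_flat (d := d) (SliceFlatHessian.cubeSum_rowDiff_rowDiff_gFlat_le d)

/-- **ROW FORM, GLOBAL, UNCONDITIONAL**: `∃ C > 0`, `‖(∇_μ∇_νΔ_1⁻¹J)(i)‖ ≤ C·(1 + log n)·|J|` for every `n ≥ 1`, every cubic unit torus, all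
`μ ν J i` — `‖∇_μ∇_νΔ_1⁻¹‖_{ℓ^∞→ℓ^∞} ≤ C(1 + log n)`, the body of `Sup112GradGradLog d 1` at `M := fun _ => N₀`. [folklore] -/
theorem sup112GradGrad_one_cubic :
    ∃ C : ℝ, 0 < C ∧
      ∀ (n N₀ : ℕ) [NeZero n] [NeZero N₀], 1 ≤ n →
        ∀ (μ ν : Fin (d + 1)) (J : Tor (fine n (fun _ : Fin (d + 1) => N₀)) × Fin (d + 1) → ℂ) (B : ℝ), (∀ j, ‖J j‖ ≤ B) →
          ∀ i, ‖(fdiff (fine n (fun _ : Fin (d + 1) => N₀)) (n : ℂ) μ *ᵥ (fdiff (fine n (fun _ : Fin (d + 1) => N₀)) (n : ℂ) ν *ᵥ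
                ((DeltaA n (fun _ : Fin (d + 1) => N₀) 1)⁻¹ *ᵥ J))) i‖
              ≤ C * (1 + Real.log n) * B :=
  sup112GradGrad_one_cubic_of_flat (d := d) (SliceFlatHessian.cubeSum_rowDiff_rowDiff_gFlat_le d)

/-- **OPERATOR FORM, LOCALIZED, UNCONDITIONAL**: `‖(Δ_1⁻¹∇_μᴴ∇_νᴴJ)_κ(x)‖ ≤ C·(1 + log n)·e^{−δ₀|y−y′|_∞}·B` for `supp J ⊆ B(y′)`, `x ∈ B(y)` —
the body of `Entry112GDivDivLog d 1` at `M := fun _ => N₀` (FILE 2's `entry112GDivDiv_one_cubic_of_flat` ∘ `hcol_swapped`). [folklore] -/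
theorem entry112GDivDiv_one_cubic :
    ∃ δ₀ C : ℝ, 0 < δ₀ ∧ 0 < C ∧
      ∀ (n N₀ : ℕ) [NeZero n] [NeZero N₀], 1 ≤ n →
        ∀ (μ ν : Fin (d + 1)) (y y' : Fin (d + 1) → ℤ) (J : Tor (fine n (fun _ : Fin (d + 1) => N₀)) × Fin (d + 1) → ℂ) (B : ℝ),
          (∀ j, ‖J j‖ ≤ B) →
          (∀ j, J j ≠ 0 → ∃ r' : Fin (d + 1) → Fin n,
              j.1 = bpt n (fun _ : Fin (d + 1) => N₀) (toT (fun _ : Fin (d + 1) => N₀) y') r') →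
          ∀ (r : Fin (d + 1) → Fin n) (κ : Fin (d + 1)),
            ‖((DeltaA n (fun _ : Fin (d + 1) => N₀) 1)⁻¹ *ᵥ ((fdiff (fine n (fun _ : Fin (d + 1) => N₀)) (n : ℂ) μ)ᴴ *ᵥ
                ((fdiff (fine n (fun _ : Fin (d + 1) => N₀)) (n : ℂ) ν)ᴴ *ᵥ J)))
                (bpt n (fun _ : Fin (d + 1) => N₀) (toT (fun _ : Fin (d + 1) => N₀) y) r, κ)‖
              ≤ C * (1 + Real.log n) * Real.exp (-(δ₀ * torusSupNorm (fun _ : Fin (d + 1) => N₀) (y - y'))) * B :=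
  entry112GDivDiv_one_cubic_of_flat (d := d) (hcol_swapped d)

/-- **OPERATOR FORM, GLOBAL, UNCONDITIONAL: `‖Δ_1⁻¹∇_μᴴ∇_νᴴ‖_{ℓ^∞→ℓ^∞} ≤ C·(1 + log n)`** for every `n ≥ 1`, every cubic unit torus, all
`μ ν` — the road-P2 owner's `‖G′∂′ᴴ∂′ᴴ‖_{∞→∞}` letter in the VECTOR currency, the body of `Sup112GDivDivLog d 1` at `M := fun _ => N₀`.
[folklore] -/
theorem sup112GDivDiv_one_cubic :
    ∃ C : ℝ, 0 < C ∧
      ∀ (n N₀ : ℕ) [NeZero n] [NeZero N₀], 1 ≤ n →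
        ∀ (μ ν : Fin (d + 1)) (J : Tor (fine n (fun _ : Fin (d + 1) => N₀)) × Fin (d + 1) → ℂ) (B : ℝ), (∀ j, ‖J j‖ ≤ B) →
          ∀ i, ‖((DeltaA n (fun _ : Fin (d + 1) => N₀) 1)⁻¹ *ᵥ ((fdiff (fine n (fun _ : Fin (d + 1) => N₀)) (n : ℂ) μ)ᴴ *ᵥ
                ((fdiff (fine n (fun _ : Fin (d + 1) => N₀)) (n : ℂ) ν)ᴴ *ᵥ J))) i‖
              ≤ C * (1 + Real.log n) * B :=
  sup112GDivDiv_one_cubic_of_flat (d := d) (hcol_swapped d)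

end Summit.QuantumFields.BalabanUV.Beta.GAN24.Entry112SupLogCubicFlat

end
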